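import Summits.QuantumFields.QCD.Theses.SpectralDefectExtinction
import Literature.MathematicalPhysics.QuantumLattice.GrassmannIntegralWilsonProofs

/-!
# Stub `stub_windowVectorEnergy` (STUB 2) of line `coercivity-at-clean-edge`
(crux `Summit.QuantumFields.QCD.Theses.SpectralDefectExtinction.TipPricing`, item stmt-QuantumFields-8967)

**Deterministic lemma (registered signature, proved): window vectors are Kato-flat.**  If
`Σ_p ‖(γ₅ D_W(U,m₀,1) ψ)_p‖² ≤ w² Σ_p ‖ψ_p‖²` with `w ≥ 0`, then `|Re (ψ† D_W(U,m₀,1) ψ)| ≤ w Σ_p ‖ψ_p‖²`.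

Proof: `γ₅` acts by signs `(1,1,−1,−1)` on the spin index (`spinorLift_gammaFive_eq_diagonal`), so
`‖(γ₅ D ψ)_p‖ = ‖(D ψ)_p‖` pointwise; then `|Re z| ≤ ‖z‖`, the triangle inequality and the real Cauchy–Schwarz
inequality `Σ ‖ψ_p‖ ‖(Dψ)_p‖ ≤ √(Σ‖ψ_p‖²) √(Σ‖(Dψ)_p‖²) ≤ √(Σ‖ψ_p‖²) · w √(Σ‖ψ_p‖²)`.
-/

noncomputable section

namespace Summit.QuantumFields.QCD.Cruxes.TipPricing.CoercivityAtCleanEdge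

open scoped BigOperators Topology Classical Matrix
open MeasureTheory Filter Matrix
open Literature.MathematicalPhysics.QuantumLattice Literature.MathematicalPhysics.QuantumFieldTheory
  Literature.Probability.LatticeModels
open Summit.QuantumFields.QCD.Theses.SpectralDefectExtinction

/-- `Γ₅ = spinorLift γ₅` acts by signs in the chiral basis, so it preserves pointwise norms:
`‖(Γ₅ v)_p‖ = ‖v_p‖`. -/
theorem windowVectorEnergy_norm_gammaFive_mulVec_apply (L : ℕ) [NeZero L]
    (v : TorusSite 4 L × Fin 3 × Fin 4 → ℂ) (p : TorusSite 4 L × Fin 3 × Fin 4) :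
    ‖((spinorLift gammaFive : Matrix (TorusSite 4 L × Fin 3 × Fin 4) (TorusSite 4 L × Fin 3 × Fin 4) ℂ) *ᵥ v) p‖ =
      ‖v p‖ := by
  rw [spinorLift_gammaFive_eq_diagonal, mulVec_diagonal, norm_mul]
  obtain ⟨x, a, s⟩ := p
  fin_cases s <;> simp

/-- Real Cauchy–Schwarz for the Hermitian pairing of two fermion fields:
`‖ψ† φ‖ ≤ √(Σ‖ψ_p‖²) · √(Σ‖φ_p‖²)`. -/
theorem windowVectorEnergy_norm_star_dotProduct_le {ι : Type*} [Fintype ι] (ψ φ : ι → ℂ) :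
    ‖star ψ ⬝ᵥ φ‖ ≤ Real.sqrt (∑ p, ‖ψ p‖ ^ 2) * Real.sqrt (∑ p, ‖φ p‖ ^ 2) := by
  calc ‖star ψ ⬝ᵥ φ‖ = ‖∑ p, star (ψ p) * φ p‖ := rfl
    _ ≤ ∑ p, ‖star (ψ p) * φ p‖ := norm_sum_le _ _
    _ = ∑ p, ‖ψ p‖ * ‖φ p‖ := Finset.sum_congr rfl fun p _ => by rw [norm_mul, norm_star]
    _ ≤ Real.sqrt (∑ p, ‖ψ p‖ ^ 2) * Real.sqrt (∑ p, ‖φ p‖ ^ 2) :=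
        Real.sum_mul_le_sqrt_mul_sqrt _ _ _

/-- **STUB 2 · window vectors are Kato-flat** (registered stub `stub_windowVectorEnergy` of line
`coercivity-at-clean-edge`, crux `TipPricing`, item stmt-QuantumFields-8967).  If
`‖γ₅ D_W(U,m₀,1) ψ‖² ≤ w² ‖ψ‖²` with `w ≥ 0` then `|Re⟨ψ, D_W(U,m₀,1) ψ⟩| ≤ w ‖ψ‖²`. -/
theorem stub_windowVectorEnergy : ∀ (L : ℕ) [NeZero L] (U : GaugeConfig 4 L ↥(Matrix.specialUnitaryGroup (Fin 3) ℂ)) (m₀ w : ℝ) (ψ : TorusSite 4 L × Fin 3 × Fin 4 → ℂ), 0 ≤ w → (∑ p, ‖((spinorLift gammaFive * wilsonDirac (fundamentalRep (Fin 3)) U m₀ 1) *ᵥ ψ) p‖ ^ 2) ≤ w ^ 2 * ∑ p, ‖ψ p‖ ^ 2 → |(star ψ ⬝ᵥ (wilsonDirac (fundamentalRep (Fin 3)) U m₀ 1 *ᵥ ψ)).re| ≤ w * ∑ p, ‖ψ p‖ ^ 2 := by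
  intro L _ U m₀ w ψ hw hH
  set D : Matrix (TorusSite 4 L × Fin 3 × Fin 4) (TorusSite 4 L × Fin 3 × Fin 4) ℂ :=
    wilsonDirac (fundamentalRep (Fin 3)) U m₀ 1 with hD
  -- `Σ ‖(Dψ)_p‖² = Σ ‖(γ₅ D ψ)_p‖² ≤ w² Σ ‖ψ_p‖²`
  have hnormD : ∑ p, ‖(D *ᵥ ψ) p‖ ^ 2 ≤ w ^ 2 * ∑ p, ‖ψ p‖ ^ 2 := by
    refine le_trans (le_of_eq ?_) hH
    refine Finset.sum_congr rfl fun p _ => ?_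
    rw [← mulVec_mulVec, windowVectorEnergy_norm_gammaFive_mulVec_apply]
  have hS0 : 0 ≤ ∑ p, ‖ψ p‖ ^ 2 := by positivity
  have hsqrtD : Real.sqrt (∑ p, ‖(D *ᵥ ψ) p‖ ^ 2) ≤ w * Real.sqrt (∑ p, ‖ψ p‖ ^ 2) := by
    calc Real.sqrt (∑ p, ‖(D *ᵥ ψ) p‖ ^ 2) ≤ Real.sqrt (w ^ 2 * ∑ p, ‖ψ p‖ ^ 2) := Real.sqrt_le_sqrt hnormD
      _ = w * Real.sqrt (∑ p, ‖ψ p‖ ^ 2) := by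
          rw [Real.sqrt_mul' _ hS0, Real.sqrt_sq hw]
  calc |(star ψ ⬝ᵥ (D *ᵥ ψ)).re| ≤ ‖star ψ ⬝ᵥ (D *ᵥ ψ)‖ := Complex.abs_re_le_norm _
    _ ≤ Real.sqrt (∑ p, ‖ψ p‖ ^ 2) * Real.sqrt (∑ p, ‖(D *ᵥ ψ) p‖ ^ 2) :=
        windowVectorEnergy_norm_star_dotProduct_le _ _
    _ ≤ Real.sqrt (∑ p, ‖ψ p‖ ^ 2) * (w * Real.sqrt (∑ p, ‖ψ p‖ ^ 2)) :=
        mul_le_mul_of_nonneg_left hsqrtD (Real.sqrt_nonneg _)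
    _ = w * (Real.sqrt (∑ p, ‖ψ p‖ ^ 2) * Real.sqrt (∑ p, ‖ψ p‖ ^ 2)) := by ring
    _ = w * ∑ p, ‖ψ p‖ ^ 2 := by rw [Real.mul_self_sqrt hS0]

end Summit.QuantumFields.QCD.Cruxes.TipPricing.CoercivityAtCleanEdge

end
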